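import Summits.BirchSwinnertonDyer.BirchSwinnertonDyer.Theorems.GoldfeldAllTwistsTwoConverseTwinEvenTwistDescent
import Summits.BirchSwinnertonDyer.BirchSwinnertonDyer.Theorems.GoldfeldAllTwistsTwoConverseTwinSplitTwistLValue
import HarnessLib

set_option linter.dupNamespace false -- namespace `…BirchSwinnertonDyer.BirchSwinnertonDyer…` is the cell's (D-0017 nested layout)
set_option autoImplicit false

/-!
# LINE C3 (EVEN-TWIST LAW), file 2: `ord₂ L^{alg}(49a1^{(2p)}, 1) = 3` for `p ≡ 5 (mod 8)` split —
# the even companion of Coates–Li–Tian–Zhai's Proposition 5.9, from Burungale–Tian + Burungale–Flach + descent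

Cell `bsd-goldfeld`, seat `bsd-goldfeld-s1p-c3x` (gen 7); planner ORDER «LINE C3» (ruling (ccxxi)), file C3-2 (after C3-1a
`…TwinEvenTwistTwoAdic`, C3-1b `…TwinEvenTwistDescent`). `--supports stmt-BirchSwinnertonDyer-19350` as a HELPER. Theses-free;
theorems only (no definition, no `sorry`); named-fact BINDERS, all in the cell's standing allowlist and consumed BY NAME:
`hBT = burungaleTian_analyticRank_eq_zero_of_selmerCorank_eq_zero_of_hasCM` (Burungale–Tian, rank-zero `2`-converse for CM
curves), `hBF = bsdTriple_of_hasCM_of_L_one_ne_zero` (Burungale–Flach, full BSD for CM curves of analytic rank `0`),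
`hnew = exists_isNewformOf` (modularity dictionary, for `L(W,1) ≠ 0 ⟺ r_an = 0`). NO new fact.

OBJECT (the one quantity the quarter-trace bookkeeping of the mixed 2-rank-two family `ℚ(√−2qp)` needs from the even partner;
memo `HOME/RK2-MIXED-FAMILY.md` §2): for a prime `p ≡ 5 (mod 8)` with `(−7/p) = +1` and every GLOBALLY MINIMAL model `W'`
of `49a1^{(2p)}`,
* `analyticRank_eq_zero_twoPosTwist`: `r_an(W') = 0` (C3-1b's `selmerCorank 2 = 0` + `hBT`);
* **`exists_LAlg_twoPosTwist`**: `L(W', 1) = q · Ω_∞(W')` with `q ∈ ℚ`, `q ≠ 0` and **`ord₂ q = 3`** — because `hBF` gives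
  `L(W',1)/Ω(W') = #Ш · Tam / #W'(ℚ)²` (`twin_centralValue_eq_of_hasCM`), `#Ш` is ODD (C3-1b: `Ш[2] = 0`), `#W'(ℚ) = 2`
  (`torsionOrder_eq_two_of_j_eq`), `Tam(W') = 32` (`tamagawaProduct_eq_thirtytwo_twoPosTwist`, from c301's uniform
  `tamagawaProduct_eq_of_smul_eq_cm7_quadraticTwist`: `8 · c_p`, `c_p = 4` for split `p`) and `Ω_∞ = Ω` (`c_∞ = 1`,
  `leastRealPeriod_eq_realPeriodRat_of_smul_eq_cm7_quadraticTwist`): `q = 8·#Ш`.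
This is the EVEN companion of CLTZ 2015 Prop. 5.9 (`ord₂ L^{alg}(49a1^{(p)},1) = 1` for split `p` with `h₈(−7p) = 0`), whose
split-`p` instance at `p ≡ 5 (mod 8)` is seat c301's `exists_LAlg_posTwist_of_symbol_neg` (file `…TwinSplitTwistLValue`, the
template followed here line by line); for `2p` at `p ≡ 5 (mod 8)` NO symbol condition is needed. Not in print as far as searched
(CLTZ §5 treats `M ≡ 1 (mod 4)` only). In the mixed-family bookkeeping it says: the genus component `P_q` of `y_K`,
`K = ℚ(√−2qp)`, is `4 × (odd) ×` the generator of `49a1(ℚ(√−q))` modulo torsion (`a_q/4` odd).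

NUMERICS (kit j294319, PARI 2.17.3; evidence on item 19350): all `182` primes `p ≡ 5 (mod 8)`, `(p/7) = +1`, `p < 12000`:
`r_an(49a1^{(2p)}) = 0`, `L/Ω_∞ = 8 · Ш_an` with `Ш_an` an ODD square (`182/182`); FALSIFIER = one such `p` with `Ш_an` even or
`L(49a1^{(2p)},1) = 0`. HONEST FRAMING: CONDITIONAL on the three named facts exactly as the route's assembly is; a statement
about the rank-ZERO even partner; no Heegner point; no case of K12₂″ / twin″ is decided; BSD is not proved by any of this.

References: Burungale–Flach, Camb. J. Math. 12 (2024) Thm 1.1, Cor. 2 [BurungaleFlach2024]; Burungale–Tian, Ann. of Math. 203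
(2026) Thm 1.1 [BurungaleTian2026]; Coates–Li–Tian–Zhai, PLMS 110 (2015) Prop. 5.9, Thm 4.4 [CoatesLiTianZhai2015];
Silverman, *AEC* X.4 [SilvermanAEC2009].
-/

noncomputable section

open scoped Classical

open WeierstrassCurve Literature.NumberTheory.EllipticCurves Literature.NumberTheory.EllipticCurves.ModularForms
  Literature.NumberTheory.EllipticCurves.Rank1Residual Summit.BirchSwinnertonDyer.Rank1Residual.P2

namespace Summit.BirchSwinnertonDyer.BirchSwinnertonDyer.Theorems.GoldfeldGoodTwists

variable {p : ℕ} [Fact p.Prime]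

/-! ## §1 Arithmetic factors of the even partner `49a1^{(2p)}` -/

/-- `2p` is squarefree, `≢ 1 (mod 4)`, prime to `7`, for a prime `p ≠ 2, 7`. [folklore] -/
theorem squarefree_two_mul_prime (hp2 : p ≠ 2) (hp7 : p ≠ 7) :
    Squarefree (2 * (p : ℤ)) ∧ (2 * (p : ℤ)) % 4 ≠ 1 ∧ ¬ (7 : ℤ) ∣ 2 * (p : ℤ) := by
  have hp : p.Prime := Fact.out
  refine ⟨?_, by omega, fun h => ?_⟩
  · have h2p : Squarefree (2 * p) := by
      rw [Nat.squarefree_mul_iff]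
      exact ⟨(Nat.coprime_primes Nat.prime_two hp).mpr (Ne.symm hp2), Nat.squarefree_two, hp.squarefree⟩
    exact_mod_cast (Int.squarefree_natCast (n := 2 * p)).mpr h2p
  · have h7 : (7 : ℤ) ∣ (p : ℤ) := by
      have h7p : Prime (7 : ℤ) := Int.prime_iff_natAbs_prime.mpr (by norm_num)
      rcases h7p.dvd_or_dvd h with h' | h'
      · norm_num at h'
      · exact h'
    exact hp7 ((Nat.prime_dvd_prime_iff_eq (by norm_num) hp).mp (by exact_mod_cast h7)).symm

/-- **`Tam(W) = 32` for every model `W` of `49a1^{(2p)}`**, `p ≡ 1 (mod 4)` prime split in `ℚ(√−7)` (`p ≠ 2, 7`):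
`c₂·c₇·c_p = 4·2·4` by seat c301's uniform law `tamagawaProduct_eq_of_smul_eq_cm7_quadraticTwist` (`8 · ∏_{ℓ∣d odd} (2|4)`).
[cite: Silverman1994, IV.9.4 and Table 4.1] -/
theorem tamagawaProduct_eq_thirtytwo_twoPosTwist (hp2 : p ≠ 2) (hp7' : p ≠ 7) (hp7 : jacobiSym p 7 = 1)
    (W : WeierstrassCurve ℚ) [W.IsElliptic] (C : VariableChange ℚ)
    (hC : C • W = cm7.quadraticTwist ((2 * (p : ℤ) : ℤ) : ℚ)) : W.tamagawaProduct = 32 := by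
  have hp : p.Prime := Fact.out
  obtain ⟨hsq, h4, h7⟩ := squarefree_two_mul_prime hp2 hp7'
  rw [tamagawaProduct_eq_of_smul_eq_cm7_quadraticTwist hsq h4 h7 W C hC]
  have hfac : ((2 * (p : ℤ)).natAbs.primeFactors.erase 2) = {p} := by
    rw [show (2 * (p : ℤ)).natAbs = 2 * p by omega, Nat.primeFactors_mul two_ne_zero hp.ne_zero,
      Nat.prime_two.primeFactors, hp.primeFactors]
    ext q
    simp only [Finset.mem_erase, Finset.mem_union, Finset.mem_singleton]
    constructor
    · rintro ⟨hq2, hq | hq⟩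
      · exact absurd hq hq2
      · exact hq
    · rintro rfl; exact ⟨hp2, Or.inr rfl⟩
  rw [hfac, Finset.prod_singleton, if_neg (by rw [hp7]; norm_num)]

/-- `ord₂ #Ш(W') = 0` for every model of `49a1^{(2p)}` with finite `Ш` (`Ш[2] = 0`, C3-1b). [cite: SilvermanAEC2009, Thm. X.4.2(a)] -/
theorem padicValNat_two_shaOrder_twoPosTwist (hp8 : p % 8 = 5) (hp7 : legendreSym p (-7) = 1)
    (W' : WeierstrassCurve ℚ) [W'.IsElliptic] (C : VariableChange ℚ)
    (hC : C • W' = cm7.quadraticTwist ((2 * (p : ℤ) : ℤ) : ℚ)) [Finite W'.sha] : padicValNat 2 W'.shaOrder = 0 := by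
  haveI : Fact (Nat.Prime 2) := ⟨Nat.prime_two⟩
  have h2 := (rank_eq_zero_and_sha_two_twoPosTwist hp8 hp7 W' C hC).2
  have hbot := W'.primaryComponent_sha_eq_bot_of_forall h2
  have hcard : Nat.card (AddCommGroup.primaryComponent W'.sha 2) = 1 := by rw [hbot]; exact AddSubgroup.card_bot
  rw [WeierstrassCurve.shaOrder, ← padicValNat_card_addPrimaryComponent (A := W'.sha) 2, hcard, padicValNat_one_right]

/-! ## §2 Analytic rank `0` and the `L`-value law -/

/-- **`L(49a1^{(2p)}, 1) ≠ 0`** (analytic rank `0`) for every model `W` of `49a1^{(2p)}`, `p ≡ 5 (mod 8)` prime split in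
`ℚ(√−7)`, granted Burungale–Tian's rank-zero `2`-converse (`corank₂ Sel_{2^∞}(W) = 0` is C3-1b's UNCONDITIONAL
`selmerCorank_two_eq_zero_twoPosTwist`). [cite: BurungaleTian2026, Thm. 1.1] -/
theorem analyticRank_eq_zero_twoPosTwist
    (hBT : burungaleTian_analyticRank_eq_zero_of_selmerCorank_eq_zero_of_hasCM)
    (hp8 : p % 8 = 5) (hp7 : legendreSym p (-7) = 1) (W : WeierstrassCurve ℚ) [W.IsElliptic]
    (C : VariableChange ℚ) (hC : C • W = cm7.quadraticTwist ((2 * (p : ℤ) : ℤ) : ℚ)) : W.analyticRank = 0 := by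
  have hp : p.Prime := Fact.out
  exact analyticRank_eq_zero_of_rank_eq_zero_of_sha_two hBT W
    (minimalModel_quadraticTwist_cm7 (mul_ne_zero two_ne_zero (by exact_mod_cast hp.ne_zero)) W C hC).2.1
    (rank_eq_zero_and_sha_two_twoPosTwist hp8 hp7 W C hC)

/-- **THE EVEN-PARTNER `L`-VALUE: `ord₂ L^{alg}(49a1^{(2p)}, 1) = 3`.** For a prime `p ≡ 5 (mod 8)` with `(−7/p) = +1`
and every GLOBALLY MINIMAL model `W'` of `49a1^{(2p)}`: `L(W',1) = q·Ω_∞(W')` with `q ≠ 0` and `ord₂ q = 3` — granted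
Burungale–Tian (`hBT`), Burungale–Flach (`hBF`: `L(1)/Ω = #Ш·Tam/#tors²`) and modularity (`hnew`); with `#Ш` odd (C3-1b),
`#tors = 2`, `Tam = 32`, so `q = 8·#Ш`. The even companion of CLTZ 2015 Prop. 5.9 / of c301's
`exists_LAlg_posTwist_of_symbol_neg`. [cite: BurungaleFlach2024, Thm. 1.1 and Cor. 2] [cite: BurungaleTian2026, Thm. 1.1]
[cite: CoatesLiTianZhai2015, Prop. 5.9 and Thm. 4.4 (shape)] -/
theorem exists_LAlg_twoPosTwist
    (hBT : burungaleTian_analyticRank_eq_zero_of_selmerCorank_eq_zero_of_hasCM)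
    (hBF : bsdTriple_of_hasCM_of_L_one_ne_zero) (hnew : exists_isNewformOf)
    (hp8 : p % 8 = 5) (hp7 : legendreSym p (-7) = 1)
    (W' : WeierstrassCurve ℚ) [W'.IsElliptic] [W'.IsGloballyMinimal]
    (hC : ∃ C : VariableChange ℚ, C • W' = cm7.quadraticTwist ((2 * (p : ℤ) : ℤ) : ℚ)) :
    ∃ q : ℚ, W'.entireLFunction 1 = ((q * CoatesLiTianZhai2015.leastRealPeriod W' : ℝ) : ℂ) ∧ q ≠ 0 ∧
      padicValRat 2 q = 3 := by
  have hp : p.Prime := Fact.out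
  obtain ⟨hp2, hp7ne, hp4⟩ := prime_ne_two_ne_seven_of_mod_eight_five hp8
  obtain ⟨C, hC⟩ := hC
  have hd0 : (2 * (p : ℤ) : ℤ) ≠ 0 := mul_ne_zero two_ne_zero (by exact_mod_cast hp.ne_zero)
  have hdQ : (((2 * (p : ℤ) : ℤ)) : ℚ) ≠ 0 := by exact_mod_cast hd0
  have hmod : hasEntireLFunction_rat := hasEntireLFunction_rat_of_exists_isNewformOf hnew
  haveI : Fact (Nat.Prime 2) := ⟨Nat.prime_two⟩
  ------------------------------------------------------------------ `r_an = 0`, `L(1) ≠ 0`, CM, `j`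
  have hr0 : W'.analyticRank = 0 := analyticRank_eq_zero_twoPosTwist hBT hp8 hp7 W' C hC
  have hL : W'.entireLFunction 1 ≠ 0 := (W'.analyticRank_eq_zero_iff_holds (hmod W')).mp hr0
  obtain ⟨hj, hcm, -⟩ := minimalModel_quadraticTwist_cm7 hd0 W' C hC
  ------------------------------------------------------------------ Burungale–Flach: `L(1)/Ω = #Ш·Tam/#W'(ℚ)²`
  obtain ⟨hfinpt, hfin, hq⟩ := twin_centralValue_eq_of_hasCM hBF hmod W' hcm hL
  haveI := hfinpt; haveI := hfin
  ------------------------------------------------------------------ the three arithmetic factors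
  have hjac : jacobiSym p 7 = 1 := by rw [← legendreSym_neg_seven_eq_jacobiSym hp2]; exact hp7
  have htam : W'.tamagawaProduct = 32 := tamagawaProduct_eq_thirtytwo_twoPosTwist hp2 hp7ne hjac W' C hC
  have hcard : Nat.card W'.toAffine.Point = 2 := by
    rw [← torsionOrder_eq_natCard_of_finite]; exact torsionOrder_eq_two_of_j_eq W' (Or.inl hj)
  have hsha : padicValNat 2 W'.shaOrder = 0 := padicValNat_two_shaOrder_twoPosTwist hp8 hp7 W' C hC
  have hS0 : W'.shaOrder ≠ 0 := (Nat.card_pos (α := W'.sha)).ne'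
  ------------------------------------------------------------------ the witness `q = twinQuotient W' = 8·#Ш`
  have hΩ : CoatesLiTianZhai2015.leastRealPeriod W' = W'.realPeriodRat :=
    leastRealPeriod_eq_realPeriodRat_of_smul_eq_cm7_quadraticTwist W' hdQ ⟨C, hC⟩
  have hΩ0 : (W'.realPeriodRat : ℂ) ≠ 0 := by exact_mod_cast (W'.realPeriodRat_pos_holds).ne'
  have htq : twinQuotient W' = 8 * (W'.shaOrder : ℚ) := by
    unfold twinQuotient; rw [htam, hcard]; push_cast; ring
  refine ⟨twinQuotient W', ?_, ?_, ?_⟩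
  · rw [hΩ]; push_cast
    rw [← hq]; field_simp
  · rw [htq]; exact mul_ne_zero (by norm_num) (by exact_mod_cast hS0)
  · have h8 : padicValRat 2 (8 : ℚ) = 3 := by
      rw [show (8 : ℚ) = ((8 : ℕ) : ℚ) by norm_num, padicValRat.of_nat]
      norm_cast
      rw [show (8 : ℕ) = 2 ^ 3 by norm_num, padicValNat.prime_pow]
    rw [htq, padicValRat.mul (by norm_num) (by exact_mod_cast hS0), padicValRat.of_nat, hsha, h8]
    norm_num

/-- **Consequences in one place** (for the PHASE-2 partner file `χ_q`): for every globally minimal `W' ≅ 49a1^{(2p)}`, `p ≡ 5 (mod 8)`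
split — `r_an(W') = 0`, `L(W',1) ≠ 0`, the full BSD triple holds (Burungale–Flach), `#Ш(W')` is finite and ODD, `#W'(ℚ) = 2`,
`Tam(W') = 32`. [cite: BurungaleFlach2024, Thm. 1.1 and Cor. 2] [cite: BurungaleTian2026, Thm. 1.1] -/
theorem rankZero_bsdTriple_twoPosTwist
    (hBT : burungaleTian_analyticRank_eq_zero_of_selmerCorank_eq_zero_of_hasCM)
    (hBF : bsdTriple_of_hasCM_of_L_one_ne_zero) (hnew : exists_isNewformOf)
    (hp8 : p % 8 = 5) (hp7 : legendreSym p (-7) = 1)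
    (W' : WeierstrassCurve ℚ) [W'.IsElliptic] [W'.IsGloballyMinimal]
    (hC : ∃ C : VariableChange ℚ, C • W' = cm7.quadraticTwist ((2 * (p : ℤ) : ℤ) : ℚ)) :
    W'.analyticRank = 0 ∧ W'.entireLFunction 1 ≠ 0 ∧ W'.BSDTriple ∧ W'.ShaFinite ∧ Odd W'.shaOrder ∧
      W'.tamagawaProduct = 32 := by
  have hp : p.Prime := Fact.out
  obtain ⟨hp2, hp7ne, -⟩ := prime_ne_two_ne_seven_of_mod_eight_five hp8
  obtain ⟨C, hC⟩ := hC
  have hd0 : (2 * (p : ℤ) : ℤ) ≠ 0 := mul_ne_zero two_ne_zero (by exact_mod_cast hp.ne_zero)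
  have hmod : hasEntireLFunction_rat := hasEntireLFunction_rat_of_exists_isNewformOf hnew
  have hr0 : W'.analyticRank = 0 := analyticRank_eq_zero_twoPosTwist hBT hp8 hp7 W' C hC
  have hL : W'.entireLFunction 1 ≠ 0 := (W'.analyticRank_eq_zero_iff_holds (hmod W')).mp hr0
  obtain ⟨_, hcm, -⟩ := minimalModel_quadraticTwist_cm7 hd0 W' C hC
  obtain ⟨hrank, hfin, hlead⟩ := hBF W' hcm hL
  have hjac : jacobiSym p 7 = 1 := by rw [← legendreSym_neg_seven_eq_jacobiSym hp2]; exact hp7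
  refine ⟨hr0, hL, ⟨hrank, hfin, hlead⟩, hfin, ?_, tamagawaProduct_eq_thirtytwo_twoPosTwist hp2 hp7ne hjac W' C hC⟩
  haveI : Finite W'.sha := hfin
  exact odd_natCard_of_forall_two_nsmul fun c hc ↦
    Subtype.ext ((rank_eq_zero_and_sha_two_twoPosTwist hp8 hp7 W' C hC).2 c c.2
      (by exact_mod_cast congrArg Subtype.val hc))

end Summit.BirchSwinnertonDyer.BirchSwinnertonDyer.Theorems.GoldfeldGoodTwists

end
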